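import Literature.Analysis.FluidPDE.MildSolutions
import Literature.Analysis.FluidPDE.HelmholtzAnnihilator
import HarnessLib

/-!
# Uniqueness of mild solutions in `C([0,T); L³)`: the Furioli–Lemarié-Rieusset–Terraneo reduction

Analysis/FluidPDE companion to `Literature/Analysis/FluidPDE/MildSolution.lean` and
`Literature/Analysis/FluidPDE/MildSolutions.lean`, whose named facts
`Literature.Analysis.FluidPDE.IsMildNSSolutionOn.ae_eq_of_continuousInLpOn_three` (general three-dimensional `E`)
and `Literature.Analysis.FluidPDE.kato_unique` (**ns.S13**, its specialisation to `ℝ³`) assert: for `ν > 0` and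
`u₀ ∈ L³`, two unforced mild solutions on `[0, T)` with datum `u₀` — in the accepted duality
(very weak) form `Fluid.IsMildNSSolutionOn (Ico 0 T)` — which both lie in `C([0,T); L³)` and are
measurable on `(0,T) × E` agree a.e. at every time `t ∈ [0, T)`.

This is **not** Kato's theorem: Kato (Math. Z. 187 (1984), Thm. 1) proves uniqueness only inside
his auxiliary class `t^{(1-3/q)/2} u ∈ C([0,T); L^q)`. Unconditional uniqueness in
`C([0,T); L³(ℝ³))` is the theorem of Furioli, Lemarié-Rieusset and Terraneo (Rev. Mat.
Iberoam. 16 (2000), Théorème 1, p. 606: `u ∈ C([0,T[; (L³)³)`, `v ∈ C([0,T'[; (L³)³)` weak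
(distributional) solutions with `u(0) = v(0)` coincide on `[0, min(T,T')[`), reproved by Meyer
(Lorentz spaces), Monniaux (maximal regularity) and Lions–Masmoudi; book form:
Lemarié-Rieusset 2016, §7.9, Thm. 7.7 (p. 147) with the three proofs sketched on pp. 147–151
(PDF pp. 169–173 of doi:10.1201/b19556). It is a theory-sized result (SIZE XL): the bilinear
Navier–Stokes operator is *not* bounded on `C([0,T); L³)` (Oru), so every proof estimates the
difference `w = u - v` in an auxiliary space (`Ḃ^{3/p-1}_{p,∞}`, `L^{3,∞}`, or `L^p_t L³_x`)
through pointwise Oseen-kernel bounds, and in the tree's very weak formulation one needs in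
addition the Helmholtz–Weyl annihilator lemma in `L^p(ℝ³)` to pass from "same pairing with all
divergence-free test fields" to "equal a.e.".

## What this file does

It isolates the analytic core of the printed proof (Lemarié-Rieusset 2016, proof of Thm. 7.7,
pp. 147–151) as ONE named sub-result and **proves the rest**:

* the **annihilator lemma** (uniqueness half of the Helmholtz–Weyl decomposition of
  `L^p(ℝⁿ)`, `1 < p < ∞`: an `L^p` vector field which is weakly divergence free *and*
  annihilates every smooth compactly supported divergence-free field vanishes a.e.; Hieber 2020,
  §1.10) is PROVED in `Literature/Analysis/FluidPDE/HelmholtzAnnihilator`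
  (`Fluid.IsWeaklyDivFree.ae_eq_zero_of_memLp_of_forall_integral_inner_eq_zero`, by
  mollification, componentwise harmonicity and Liouville's theorem in `L^p`). It is used once,
  at `t = 0`, where the two duality identities only say that `u 0` and `v 0` have the same
  pairing with divergence-free tests.
* `Literature.Analysis.FluidPDE.IsMildNSSolutionOn.ae_eq_Ico_of_ae_eq_Icc_three` — **local forward uniqueness
  from a coincidence time** (named fact): if the two solutions agree a.e. at every time of
  `[0, τ₀]`, `τ₀ ∈ [0, T)`, they agree a.e. on `[τ₀, τ₀ + ε) ∩ [0, T)` for some `ε > 0`. This is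
  exactly the local statement to which Lemarié-Rieusset reduces Thm. 7.7 (first step of the
  proof, p. 147: "if we prove that … there exists some positive `ε` so that `u = v` on
  `[0, ε]`", applied to the restarted solutions `u(· + τ*)`, `v(· + τ*)`), i.e. the analytic
  core of the theorem (steps 2–3, pp. 148–150: the fixed-point equation (7.54) for `w` and
  Meyer's `L^{3,∞}` contraction), transported to the duality formulation (very weak ⇔ Oseen
  integral equation in these classes: Lemarié-Rieusset 2016, Thm. 6.1 and Prop. 6.5,
  pp. 113–114).

The assembly `Literature.Analysis.FluidPDE.IsMildNSSolutionOn.ae_eq_of_continuousInLpOn_three_of` (whence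
`Literature.Analysis.FluidPDE.kato_unique_of`) is the printed first step (pp. 147–148), a "continuous induction" on
`[0, t]`, PROVED: the coincidence set `{s | u s = v s a.e.}` contains `0` (annihilator lemma),
is closed in `[0, t]` (continuity of both solutions in `L³`:
`‖u r - v r‖₃ ≤ ‖u s - u r‖₃ + ‖v s - v r‖₃` whenever `u s = v s` a.e.), and is open to the
right (local forward uniqueness); Mathlib's `IsClosed.Icc_subset_of_forall_mem_nhdsGT_of_Icc_subset`
concludes. What remains for `kato_unique_holds` is the discharge of the local forward
uniqueness fact (plan: Oseen kernel bounds and Meyer's `L^{3,∞}` estimates,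
Lemarié-Rieusset 2016, pp. 148–150).

## Mathlib / tree search

Mathlib (this pin) has no Helmholtz decomposition, no Leray projector on `L^p`, `p ≠ 2`, no
Liouville theorem for harmonic functions on `ℝⁿ`, `n ≥ 3` (only on `ℂ`:
`Mathlib/Analysis/Complex/Harmonic/Liouville.lean`), no Lorentz spaces and no Oseen kernel; the
tree has the `L²` Leray projector (`Fluid.lerayProjector`, `LerayProjector.lean`), heat-kernel
`L^p` smoothing (`HeatKernelLpSmoothingProofs.lean`) and now the `L^p` annihilator lemma
(`HelmholtzAnnihilator.lean`); nothing reaches the local forward uniqueness fact (no Lorentz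
spaces, no Oseen kernel). Used from Mathlib: `IsClosed.Icc_subset_of_forall_mem_nhdsGT_of_Icc_subset`,
`ge_of_tendsto`, `eLpNorm_sub_le`, `eLpNorm_eq_zero_iff`, `MemLp.locallyIntegrable`.

## References

* G. Furioli, P. G. Lemarié-Rieusset, E. Terraneo, *Unicité dans `L³(ℝ³)` et d'autres espaces
  fonctionnels limites pour Navier–Stokes*, Rev. Mat. Iberoam. 16 (2000), 605–667, Théorème 1
  (p. 606). Bib key `FurioliLemarierieussetTerraneo2000`.
* P. G. Lemarié-Rieusset, *The Navier–Stokes problem in the 21st century*, CRC Press 2016: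
  Thm. 4.4 (pp. 56–57), Def. 6.2 and Lemma 6.3 (p. 104), Thm. 6.1 and Prop. 6.5 (pp. 113–114),
  §7.9, Thm. 7.7 (p. 147) and its proof (pp. 147–151). Bib key `LemarieRieusset2016`.
* M. Hieber, *Analysis of viscous fluid flows: an approach by evolution equations*, in:
  Mathematical Analysis of the Navier–Stokes Equations, LNM 2254, Springer 2020, 1–146, §1.10
  (Def. 1.10.1, Lemma 1.10.2, Remarks 1.10.3, Prop. 1.10.4). Bib key `Hieber2020`.
* T. Kato, *Strong `L^p`-solutions of the Navier–Stokes equation in `ℝ^m`, with applications to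
  weak solutions*, Math. Z. 187 (1984), 471–480, Thm. 1 (uniqueness within his class only).
* Y. Meyer, *Wavelets, paraproducts and Navier–Stokes equations*, Current developments in
  mathematics 1996, Int. Press 1997 (the `L^{3,∞}` proof, as reported in Lemarié-Rieusset 2016,
  p. 150).
-/

noncomputable section

open MeasureTheory TopologicalSpace Set Function Filter Topology
open scoped InnerProductSpace RealInnerProductSpace ENNReal NNReal

namespace Literature.Analysis.FluidPDE

/-! ### Differences of weakly divergence-free fields -/

section Pairing

variable {E : Type*} [NormedAddCommGroup E] [InnerProductSpace ℝ E] [FiniteDimensional ℝ E]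
  [MeasurableSpace E] [BorelSpace E]
variable {F' : Type*} [NormedAddCommGroup F'] [InnerProductSpace ℝ F']

/-- The difference of two weakly divergence-free `L^p` fields, `1 ≤ p`, is weakly divergence free
(linearity of the weak identity `∫ ⟪·, ∇θ⟫ = 0`; both pairings are genuine integrals because
`∇θ` is continuous with compact support; Evans, *PDE*, §5.2.1). [folklore] -/
theorem IsWeaklyDivFree.sub {p : ℝ≥0∞} (hp : 1 ≤ p) {u v : E → E} (hu : IsWeaklyDivFree u)
    (hv : IsWeaklyDivFree v) (hum : MemLp u p volume) (hvm : MemLp v p volume) :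
    IsWeaklyDivFree (u - v) := by
  intro θ hθ
  have hgc : Continuous (gradient θ) :=
    (InnerProductSpace.toDual ℝ E).symm.continuous.comp (hθ.contDiff.continuous_fderiv (by simp))
  have hgs : HasCompactSupport (gradient θ) :=
    (hθ.hasCompactSupport.fderiv (𝕜 := ℝ)).comp_left (g := (InnerProductSpace.toDual ℝ E).symm)
      (map_zero _)
  have iu := integrable_inner_of_locallyIntegrable_of_hasCompactSupport
    (hum.locallyIntegrable hp) hgc hgs
  have iv := integrable_inner_of_locallyIntegrable_of_hasCompactSupport
    (hvm.locallyIntegrable hp) hgc hgs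
  simp only [Pi.sub_apply, inner_sub_left]
  rw [integral_sub iu iv, hu θ hθ, hv θ hθ, sub_zero]

end Pairing

/-! ### The named fact: local forward uniqueness in `C([0,T); L³)` from a coincidence time -/

section LocalUniqueness

variable {E : Type*} [NormedAddCommGroup E] [InnerProductSpace ℝ E] [FiniteDimensional ℝ E]
  [MeasurableSpace E] [BorelSpace E]
variable {ν T : ℝ} {u v : ℝ → E → E} {u₀ : E → E}

/-- **Local forward uniqueness of mild solutions in `C([0,T); L³)`, three-dimensional space**
(the analytic core of Furioli–Lemarié-Rieusset–Terraneo 2000, Théorème 1, p. 606, in the form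
isolated by Lemarié-Rieusset 2016, proof of Thm. 7.7, p. 147: local uniqueness on `[0, ε]`,
applied after restarting at a coincidence time `τ*`; proved there, pp. 148–150, by the
fixed-point equation (7.54) for `w = u - v` and Meyer's contraction estimate in
`L^∞_t L^{3,∞}_x`, `sup_{t<τ} ‖w‖_{L^{3,∞}} ≤ C A(τ) sup_{t<τ} ‖w‖_{L^{3,∞}}` with `A(τ) → 0`).
Let `dim E = 3`, `ν > 0`, `u₀ ∈ L³`, and let `u`, `v` be unforced mild solutions on `[0, T)` with
datum `u₀` in the duality form (`Fluid.IsMildNSSolutionOn (Ico 0 T)`; in these classes this is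
the Oseen integral equation, Lemarié-Rieusset 2016, Thm. 6.1 and Prop. 6.5, pp. 113–114), both
in `C([0,T); L³)` and measurable on `(0,T) × E`. If `τ₀ ∈ [0, T)` and `u s = v s` a.e. for
every `s ∈ [0, τ₀]`, then there is `ε > 0` such that `u s = v s` a.e. for every
`s ∈ [τ₀, τ₀ + ε)` with `s < T`. Together with the annihilator lemma (which supplies the case
`τ₀ = 0`, `u 0 = v 0` a.e.) and the continuation argument proved below, this is uniqueness in
`C([0,T); L³)` (`IsMildNSSolutionOn.ae_eq_of_continuousInLpOn_three_of`). [cite: LemarieRieusset2016, Thm. 7.7 (p. 147) and its proof, pp. 147–150] -/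
def IsMildNSSolutionOn.ae_eq_Ico_of_ae_eq_Icc_three : Prop :=
  ∀ (_hd : Module.finrank ℝ E = 3) (_hν : 0 < ν) (_hu₀ : MemLp u₀ 3 (volume : Measure E))
    (_h₁ : IsMildNSSolutionOn (Ico 0 T) ν 0 u₀ u) (_h₂ : IsMildNSSolutionOn (Ico 0 T) ν 0 u₀ v)
    (_hu : ContinuousInLpOn (Ico 0 T) 3 u) (_hv : ContinuousInLpOn (Ico 0 T) 3 v)
    (_hmu : AEStronglyMeasurable (uncurry u) (volume.restrict (Ioo 0 T ×ˢ univ)))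
    (_hmv : AEStronglyMeasurable (uncurry v) (volume.restrict (Ioo 0 T ×ˢ univ)))
    ⦃τ₀ : ℝ⦄ (_hτ₀ : τ₀ ∈ Ico 0 T) (_hco : ∀ s ∈ Icc 0 τ₀, u s =ᵐ[volume] v s),
    ∃ ε : ℝ, 0 < ε ∧ ∀ s ∈ Ico τ₀ (τ₀ + ε), s < T → u s =ᵐ[volume] v s

/-! ### The assembly: continuation from local to global uniqueness (proved) -/

/-- **Closedness of the coincidence set** (Lemarié-Rieusset 2016, proof of Thm. 7.7, first step,
p. 147: "by continuity, we have `u(τ*, ·) = v(τ*, ·)` in `(L³)³`"). If `u, v ∈ C(S; L³)` and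
`r ∈ S` is a limit, within `S`, of times `s` at which `u s = v s` a.e. (formally: the set of such
times meets every neighbourhood of `r` within `S`, `(𝓝[S ∩ {s | u s = v s a.e.}] r).NeBot`), then
`u r = v r` a.e.: `‖u r - v r‖₃ ≤ ‖u s - u r‖₃ + ‖v s - v r‖₃ → 0`. [cite: LemarieRieusset2016, proof of Thm. 7.7, first step, p. 147] -/
theorem ContinuousInLpOn.ae_eq_of_neBot {S : Set ℝ} {p : ℝ≥0∞} (hp : 1 ≤ p)
    (hu : ContinuousInLpOn S p u) (hv : ContinuousInLpOn S p v) {r : ℝ} (hr : r ∈ S)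
    (hne : (𝓝[S ∩ {s | u s =ᵐ[volume] v s}] r).NeBot) : u r =ᵐ[volume] v r := by
  have hp0 : p ≠ 0 := (zero_lt_one.trans_le hp).ne'
  set Z : Set ℝ := S ∩ {s | u s =ᵐ[volume] v s} with hZ
  have hsub : Z ⊆ S := inter_subset_left
  have e₁ : Tendsto (fun s => eLpNorm (u s - u r) p volume) (𝓝[Z] r) (𝓝 0) :=
    (hu.2 r hr).mono_left (nhdsWithin_mono r hsub)
  have e₂ : Tendsto (fun s => eLpNorm (v s - v r) p volume) (𝓝[Z] r) (𝓝 0) :=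
    (hv.2 r hr).mono_left (nhdsWithin_mono r hsub)
  have elim : Tendsto (fun s => eLpNorm (u s - u r) p volume + eLpNorm (v s - v r) p volume)
      (𝓝[Z] r) (𝓝 0) := by
    simpa using e₁.add e₂
  have hle : ∀ᶠ s in 𝓝[Z] r, eLpNorm (u r - v r) p volume ≤
      eLpNorm (u s - u r) p volume + eLpNorm (v s - v r) p volume := by
    filter_upwards [self_mem_nhdsWithin] with s hs
    have hsS : s ∈ S := hsub hs
    calc eLpNorm (u r - v r) p volume = eLpNorm ((v s - v r) - (u s - u r)) p volume := by
          refine eLpNorm_congr_ae ?_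
          filter_upwards [hs.2] with x hx
          simp only [Pi.sub_apply, hx]
          abel
      _ ≤ eLpNorm (v s - v r) p volume + eLpNorm (u s - u r) p volume :=
          eLpNorm_sub_le ((hv.1 s hsS).1.sub (hv.1 r hr).1) ((hu.1 s hsS).1.sub (hu.1 r hr).1) hp
      _ = eLpNorm (u s - u r) p volume + eLpNorm (v s - v r) p volume := add_comm _ _
  have h0 : eLpNorm (u r - v r) p volume ≤ 0 := ge_of_tendsto elim hle
  have hzero : eLpNorm (u r - v r) p volume = 0 := le_antisymm h0 bot_le
  exact (sub_ae_eq_zero _ _).1 ((eLpNorm_eq_zero_iff ((hu.1 r hr).1.sub (hv.1 r hr).1) hp0).1 hzero)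

/-- **Uniqueness in `C([0,T); L³)` from local forward uniqueness** (Lemarié-Rieusset 2016,
Thm. 7.7, p. 147, first step of the proof = the continuation argument, PROVED here): given local
forward uniqueness (`IsMildNSSolutionOn.ae_eq_Ico_of_ae_eq_Icc_three`), the accepted fact
`IsMildNSSolutionOn.ae_eq_of_continuousInLpOn_three` follows by continuous induction on
`[0, t]`: the coincidence set contains `0` — `u 0 - v 0` is weakly divergence free and pairs to
`0` with every divergence-free test field by the two duality identities at time `0`
(`IsMildNSSolutionOn.integral_inner_zero_eq`), hence vanishes a.e. by the annihilator lemma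
(`IsWeaklyDivFree.ae_eq_zero_of_memLp_of_forall_integral_inner_eq_zero`, PROVED in
`HelmholtzAnnihilator`) —, is closed in `[0, t]` by `L³`-continuity
(`ContinuousInLpOn.ae_eq_of_neBot`) and is open to the right, so it is all of `[0, t]`
(`IsClosed.Icc_subset_of_forall_mem_nhdsGT_of_Icc_subset`). [cite: LemarieRieusset2016, Thm. 7.7 and proof, first step, p. 147] -/
theorem IsMildNSSolutionOn.ae_eq_of_continuousInLpOn_three_of
    (hB : IsMildNSSolutionOn.ae_eq_Ico_of_ae_eq_Icc_three (E := E) (ν := ν) (T := T) (u := u)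
      (v := v) (u₀ := u₀)) :
    IsMildNSSolutionOn.ae_eq_of_continuousInLpOn_three (E := E) (ν := ν) (T := T) (u := u)
      (v := v) (u₀ := u₀) := by
  intro hd hν hu₀ h₁ h₂ hu hv hmu hmv t ht
  have h3 : (1 : ℝ≥0∞) ≤ 3 := by norm_num
  have hT : (0 : ℝ) < T := ht.1.trans_lt ht.2
  have h0T : (0 : ℝ) ∈ Ico 0 T := ⟨le_rfl, hT⟩
  -- the coincidence set
  set Z : Set ℝ := {s | u s =ᵐ[volume] v s} with hZ
  -- (i) `0 ∈ Z`: the annihilator lemma (PROVED, `HelmholtzAnnihilator`) applied to `u 0 - v 0`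
  have h0 : (0 : ℝ) ∈ Z := by
    have hw : MemLp (u 0 - v 0) 3 volume := (hu.1 0 h0T).sub (hv.1 0 h0T)
    have hdiv : IsWeaklyDivFree (u 0 - v 0) :=
      (h₁.1 0 h0T).sub h3 (h₂.1 0 h0T) (hu.1 0 h0T) (hv.1 0 h0T)
    have horth : ∀ φ : E → E, FunctionSpaces.IsTestFunctionOn (⊤ : Opens E) φ → VectorCalculus.IsDivFree φ →
        ∫ x, ⟪(u 0 - v 0) x, φ x⟫ = 0 := by
      intro φ hφ hφd
      have e₁ := h₁.integral_inner_zero_eq h0T hφ hφd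
      have e₂ := h₂.integral_inner_zero_eq h0T hφ hφd
      have i₁ := integrable_inner_of_locallyIntegrable_of_hasCompactSupport
        ((hu.1 0 h0T).locallyIntegrable h3) hφ.contDiff.continuous hφ.hasCompactSupport
      have i₂ := integrable_inner_of_locallyIntegrable_of_hasCompactSupport
        ((hv.1 0 h0T).locallyIntegrable h3) hφ.contDiff.continuous hφ.hasCompactSupport
      simp only [Pi.sub_apply, inner_sub_left]
      rw [integral_sub i₁ i₂, e₁, e₂, sub_self]
    have hae := IsWeaklyDivFree.ae_eq_zero_of_memLp_of_forall_integral_inner_eq_zero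
      (by norm_num) (by simp) hw hdiv horth
    exact (sub_ae_eq_zero _ _).1 hae
  -- (ii) `Z ∩ [0, t]` is closed (continuity in `L³` on `[0, T) ⊇ [0, t]`)
  have hclosed : IsClosed (Z ∩ Icc 0 t) := by
    refine isClosed_of_closure_subset fun r hr => ?_
    have hrI : r ∈ Icc 0 t := by
      have : r ∈ closure (Icc 0 t) := closure_mono inter_subset_right hr
      rwa [closure_Icc] at this
    have hrT : r ∈ Ico 0 T := ⟨hrI.1, hrI.2.trans_lt ht.2⟩
    refine ⟨?_, hrI⟩
    have hne : (𝓝[Z ∩ Icc 0 t] r).NeBot := mem_closure_iff_nhdsWithin_neBot.1 hr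
    have hsub : Z ∩ Icc 0 t ⊆ Ico 0 T ∩ {s | u s =ᵐ[volume] v s} :=
      fun s hs => ⟨⟨hs.2.1, hs.2.2.trans_lt ht.2⟩, hs.1⟩
    have hne' : (𝓝[Ico 0 T ∩ {s | u s =ᵐ[volume] v s}] r).NeBot :=
      hne.mono (nhdsWithin_mono r hsub)
    exact hu.ae_eq_of_neBot h3 hv hrT hne'
  -- (iii) `Z` is open to the right at every coincidence time (local forward uniqueness)
  have hstep : ∀ τ ∈ Ico 0 t, Icc 0 τ ⊆ Z → Z ∈ 𝓝[>] τ := by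
    intro τ hτ hIcc
    have hτT : τ ∈ Ico 0 T := ⟨hτ.1, hτ.2.trans ht.2⟩
    obtain ⟨ε, hε, hext⟩ := hB hd hν hu₀ h₁ h₂ hu hv hmu hmv hτT (fun s hs => hIcc hs)
    have hmem : Ioo τ (min (τ + ε) T) ∈ 𝓝[>] τ := Ioo_mem_nhdsGT (lt_min (by linarith) hτT.2)
    filter_upwards [hmem] with s hs
    exact hext s ⟨hs.1.le, hs.2.trans_le (min_le_left _ _)⟩ (hs.2.trans_le (min_le_right _ _))
  -- continuous induction on `[0, t]`
  exact IsClosed.Icc_subset_of_forall_mem_nhdsGT_of_Icc_subset hclosed h0 hstep ⟨ht.1, le_rfl⟩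

end LocalUniqueness

end Literature.Analysis.FluidPDE

/-! ### Specialisation to `ℝ³`: `Literature.Analysis.FluidPDE.kato_unique` -/

namespace Literature.Analysis.FluidPDE

/-- `kato_unique` **is** the accepted general fact
`Fluid.IsMildNSSolutionOn.ae_eq_of_continuousInLpOn_three` specialised to
`ℝ³` via `finrank_euclideanSpace_fin` (this was the interim proof
recorded in `MildSolutions.lean`; Furioli–Lemarié-Rieusset–Terraneo 2000, Théorème 1). [cite: FurioliLemarierieussetTerraneo2000, Théorème 1, p. 606] -/
theorem kato_unique_of_ae_eq_of_continuousInLpOn_three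
    (h : ∀ {ν T : ℝ} {u v : ℝ → EuclideanSpace ℝ (Fin 3) → EuclideanSpace ℝ (Fin 3)}
      {u₀ : EuclideanSpace ℝ (Fin 3) → EuclideanSpace ℝ (Fin 3)},
      IsMildNSSolutionOn.ae_eq_of_continuousInLpOn_three (E := EuclideanSpace ℝ (Fin 3))
        (ν := ν) (T := T) (u := u) (v := v) (u₀ := u₀)) :
    kato_unique := by
  intro ν T hν u₀ u v hu₀ hu hv huc hvc hmu hmv
  exact h finrank_euclideanSpace_fin hν hu₀ hu hv huc hvc hmu hmv

/-- **`kato_unique` from local forward uniqueness** (Furioli–Lemarié-Rieusset–Terraneo 2000,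
Théorème 1, p. 606; Lemarié-Rieusset 2016, Thm. 7.7): local forward uniqueness in
`C([0,T); L³(ℝ³))` (the named fact `Fluid.IsMildNSSolutionOn.ae_eq_Ico_of_ae_eq_Icc_three` on
`ℝ³`) implies uniqueness of mild solutions in `C([0,T); L³(ℝ³))`, by
`Fluid.IsMildNSSolutionOn.ae_eq_of_continuousInLpOn_three_of` (annihilator lemma + continuation,
PROVED) and `finrank_euclideanSpace_fin`. [cite: FurioliLemarierieussetTerraneo2000, Théorème 1, p. 606] -/
theorem kato_unique_of
    (hB : ∀ {ν T : ℝ} {u v : ℝ → EuclideanSpace ℝ (Fin 3) → EuclideanSpace ℝ (Fin 3)}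
      {u₀ : EuclideanSpace ℝ (Fin 3) → EuclideanSpace ℝ (Fin 3)},
      IsMildNSSolutionOn.ae_eq_Ico_of_ae_eq_Icc_three (E := EuclideanSpace ℝ (Fin 3))
        (ν := ν) (T := T) (u := u) (v := v) (u₀ := u₀)) :
    kato_unique :=
  kato_unique_of_ae_eq_of_continuousInLpOn_three fun {_ _ _ _ _} =>
    IsMildNSSolutionOn.ae_eq_of_continuousInLpOn_three_of hB

end Literature.Analysis.FluidPDE
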